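import Summits.CriticalPhenomena.PercolationContinuityZ3.Theorems.PercNearOneGluingNoHeavyLowerTailSahiSharedTwoPoint
import Mathlib.Tactic.Linarith
import Mathlib.Tactic.Ring
import Mathlib.Tactic.FieldSimp
import Mathlib.Tactic.Positivity
import HarnessLib

/-!
# `NoHeavyLowerTail` (crux stmt-CriticalPhenomena-4575), P2: the RESAMPLED MARGIN of Kahn's inequality —
# `M = E_3 − E_c Cov_b(g_c, Y_c)`: the identity, the principal-member theorem, and the 4-coin COUNTEREXAMPLE

Support file of the one-cut programme (Sahi's algebraic route, seat `prim-masterthm-p2`, gen 24; memo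
`run/shared/lean/prim/prim-masterthm/FROM-prim-masterthm-p2-g24-RESAMPLED-MARGIN.md`; `--supports stmt-CriticalPhenomena-4575`).
No `sorry`, no named facts, no conjectures; standard axioms.  Small definitions (`KK`, `KH`, `fibreCov`, `kplusMargin`, `pind`, and the five
constants of the counterexample).

SETTING (`…SahiSharedTwoPointIdentity`): finite blocks `α, β, γ` with probability weights `wA, wB, wC`; `f : γ → α → ℝ`, `g : γ → β → ℝ`,
`h : γ → α → β → ℝ` (every triple of functions on a product of three independent blocks has this shape once `γ ⊇ supp f ∩ supp g`;
`h` is unrestricted); `Y(c,b) = E_a[f(c,·)h(c,·,b)]`, `F = E_a f`, `G_C = E_b g`, `Ȳ = E_b Y`, `EF, EH, Ḡ` the means.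

* `KK c = E_b[g(c,·)Y(c,·)]` (`= E[fgh | c]`), `fibreCov = E_c[E_b(g_c Y_c) − G_C(c)Ȳ(c)] = E_c Cov_b(g_c, Y_c)` (the FIBRE COVARIANCE), and the
  **RESAMPLED MARGIN** `kplusMargin = Cov(f, gh) + Cov_c(G_C, Ȳ − EH·F)`.
* `sahiE_three_eq_kplusMargin_add_fibreCov` — **`E_3(f,g,h) = kplusMargin + fibreCov`**: the `r ≡ 1` member of the tree's ratio family
  (`SahiSharedTwoPoint.sahiE_three_eq_of_ratio`: `M = E_b[Φ_1 + Δ_1]`), in closed form.  Since `E_c Cov_b(g_c,Y_c) = E[fgh] − E[f g' h]` with `g' = g`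
  evaluated on an INDEPENDENT COPY of the block `β`, the margin is Kahn's expression with ONE of its two `E[fgh]` resampled:
  `M = E[fgh] + E[fg'h] + Ef·Eg·Eh − Ef·E[gh] − Eg·E[fh] − Eh·E[fg]`.
* `fibreCov_nonneg` (FKG on `β`), hence `kplusMargin_le_sahiE_three` and `sahiE_three_nonneg_of_kplusMargin_nonneg`: `M ≥ 0` implies Sahi's `C_3` /
  Kahn's inequality for the triple, with the explicit slack `E_c Cov_b(g_c, Y_c) ≥ 0`.
* `kplusMargin_eq_of_ignores` — when `f` ignores the block `α` (`f c a = φ c`; for cubes `γ ⊇ supp f`): `M = E_c[φ·(G_C − Ḡ)(H̄ − EH)] + Cov_c(φ, K')`,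
  `K'(c) = E[gh | c]` — the first-slot form: `M` sees `g, h` only through the three `γ`-marginals `G_C, H̄, K'` of `g, h, gh`
  (Kahn's `E_3` itself is `M + E_c[φ·Cov_b(g_c,h_c)]`, first-slot linearity).
* `fkg_sum_signed`, `fkg_sum_principal` — FKG for signed monotone functions, and for an FKG weight RESTRICTED to a principal up-set `{c | u₀ ≤ c}`.
* **`kplusMargin_nonneg_of_principal`** — `M ≥ 0` when the first member is the indicator of a PRINCIPAL up-set of `γ` (`f c a = 1[u₀ ≤ c]`; for cubes a
  monomial `x_{s₁} ∧ ⋯ ∧ x_{s_k}`), `γ` any finite distributive lattice with an FKG weight, `g, h ≥ 0` monotone in `c`, NO hypothesis on `β`; with FKG on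
  `α, β`: `E_3(1_{[u₀,⊤]}, g, h) ≥ M ≥ 0` (`sahiE_three_nonneg_of_principal`; Sahi's `C_3` for a principal member on any FKG product of blocks).
* **`kplusMargin_example_neg`, `fibreCov_example`, `sahiE_three_example` — THE MARGIN CAN BE NEGATIVE**: on the uniform 4-cube, the class-T triple
  `(x₀ ∨ x₁, x₂(x₀ ∨ x₃), x₃(x₁ ∨ x₂))` (blocks `γ = {x₀}`, `α = {x₁}`, `β = {x₂,x₃}`; `gh = x₂x₃` is independent of `f`) has `M = −1/256`,
  `fibreCov = 1/16`, `E_3 = 15/256`.  So the natural strengthening "`E_3 ≥ E_c Cov_b(g_c,Y_c)`" of Kahn's Conjecture 5 (equivalently: the averaged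
  `r ≡ 1` certificate `E_b[Φ_1 + Δ_1] ≥ 0`; equivalently: Kahn's inequality with one `E[fgh]` resampled outside `supp f`) is FALSE — the fibre slack is
  needed — although it holds for a principal first member and in all but ≈ 7·10⁻⁶ of cells.

CENSUS (seat gen 24, kit j194784, exact recheck of every float-negative cell): exhaustive ordered triples of nonconstant up-sets of the 4-cube × 75 bias
vectors: 343 072 200 cells, 1 800 with `M < 0`, ONE `S_4`-orbit `(x_a∨x_b, x_c(x_a∨x_d), x_d(x_b∨x_c))` (up to the `g ↔ h` role swap), minimum `−1/256`
at `p ≡ 1/2`; random `n = 5..8` (49.2·10⁶ cells, biases down to `1/100`): 644 further failing cells in 628 triples.  The two-sided version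
`E_3 ≥ E_c[Cov_b(g_c,Y_c) + Cov_a(f_c,Z_c)]` ("conditioning on the shared block lowers `E_3`") fails already in random samples (4/1 200).
HONEST LABEL: identities, one positive theorem, one refutation; `SahiTwoLevelPlus` and Kahn's Conjecture 5 / Sahi's `C_3` remain OPEN.
[cite: Kahn2022, Conj. 5 (arXiv p. 3); Sahi2008, Conj. 5] [this work]
-/

noncomputable section

open scoped Classical

namespace Summit.CriticalPhenomena.PercolationContinuityZ3.Theorems

namespace SahiResampledMargin

open Finset
open Literature.Combinatorics.Sahi2008
open SahiTriangleSupermodular (fkg_sum)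
open SahiTriangleClassT (swap_bc pull)
open SahiSharedTwoPoint (Y FC HH GG GC Ybar Hbar EH EF Gbar expectations covpart_nonneg_of_ratio)

section Defs
variable {α β γ : Type} [Fintype α] [Fintype β] [Fintype γ]
  (wA : α → ℝ) (wB : β → ℝ) (wC : γ → ℝ) (f : γ → α → ℝ) (g : γ → β → ℝ) (h : γ → α → β → ℝ)

/-- `K(c) = E_b[g(c,b)·Y(c,b)] = E[f g h | c]`, the fibre moment of the product. [this work] -/
def KK (c : γ) : ℝ := ∑ b, wB b * (g c b * Y wA f h c b)

/-- The FIBRE COVARIANCE `E_c Cov_b(g(c,·), Y(c,·)) = E_c[K(c) − G_C(c)Ȳ(c)]` (`= E[fgh] − E[f g' h]`, `g'` an independent copy of `g` on the block `β`).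
[this work] -/
def fibreCov : ℝ := ∑ c, wC c * (KK wA wB f g h c - GC wB g c * Ybar wA wB f h c)

/-- The **resampled margin** `M = Cov(f, gh) + Cov_c(G_C, Ȳ − EH·F)`
(`= [E(fgh) − EF·E(gh)] + [E_c(G_C Ȳ) − EH·E_c(F G_C) − Ḡ·(E_c Ȳ − EH·EF)]`). [this work] -/
def kplusMargin : ℝ :=
  ((∑ c, wC c * KK wA wB f g h c) - EF wA wC f * ∑ c, wC c * ∑ b, wB b * (g c b * HH wA h c b)) +
    (((∑ c, wC c * (GC wB g c * Ybar wA wB f h c)) - EH wA wB wC h * ∑ c, wC c * (FC wA f c * GC wB g c)) -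
      Gbar wB wC g * ((∑ c, wC c * Ybar wA wB f h c) - EH wA wB wC h * EF wA wC f))

/-- `K'(c) = E_b[g(c,b)·H(c,b)] = E[g h | c]` (the `γ`-marginal of `gh`; equals `K(c)/φ(c)` when `f c a = φ c`). [this work] -/
def KH (c : γ) : ℝ := ∑ b, wB b * (g c b * HH wA h c b)
end Defs

section Main
variable {α β γ : Type} [Fintype α] [Fintype β] [Fintype γ]
  {wA : α → ℝ} {wB : β → ℝ} {wC : γ → ℝ} {f : γ → α → ℝ} {g : γ → β → ℝ} {h : γ → α → β → ℝ}

/-! ### 1. The identity `E_3 = M + fibreCov` and the reduction `M ≥ 0 ⟹ E_3 ≥ 0` -/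

/-- **`E_3(f,g,h) = kplusMargin + fibreCov`** (any finite blocks, any weights with `Σ wA = Σ wB = 1`; a bookkeeping identity). [this work] -/
theorem sahiE_three_eq_kplusMargin_add_fibreCov (hA1 : ∑ a, wA a = 1) (hB1 : ∑ b, wB b = 1) :
    sahiE (fun q : α × β × γ => wA q.1 * wB q.2.1 * wC q.2.2) 3
        ![fun q => f q.2.2 q.1, fun q => g q.2.2 q.2.1, fun q => h q.2.2 q.1 q.2.1] =
      kplusMargin wA wB wC f g h + fibreCov wA wB wC f g h := by
  obtain ⟨eFGH, eFG, eFH, eF, eGH, eG, eH⟩ := expectations (wC := wC) (f := f) (g := g) (h := h) hA1 hB1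
  rw [sahiE_three, eFGH, eFG, eFH, eF, eGH, eG, eH]
  unfold kplusMargin fibreCov KK
  simp only [mul_sub, sum_sub_distrib]
  ring

/-- The fibre covariance is nonnegative (FKG on `β`; `f, h ≥ 0`, `g, h` monotone in `b`). [this work] -/
theorem fibreCov_nonneg [DistribLattice α] [DistribLattice β] [Preorder γ]
    (hA : IsFKGMeasure wA) (hB : IsFKGMeasure wB) (hC0 : ∀ c, 0 ≤ wC c)
    (hf0 : ∀ c a, 0 ≤ f c a) (hg0 : ∀ c b, 0 ≤ g c b) (hgb : ∀ c, Monotone (g c))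
    (hh0 : ∀ c a b, 0 ≤ h c a b) (hhb : ∀ c a, Monotone (h c a)) :
    0 ≤ fibreCov wA wB wC f g h := by
  have h1 := covpart_nonneg_of_ratio (wC := wC) (f := f) (g := g) (h := h) (r := fun _ => (1 : ℝ))
    hA hB hC0 hf0 hg0 hgb hh0 hhb (fun _ => zero_le_one) (fun _ => le_rfl)
  unfold fibreCov KK
  refine le_of_le_of_eq h1 (sum_congr rfl fun c _ => ?_)
  ring

/-- **`M ≤ E_3`**: the resampled margin is a lower bound for Sahi's `E_3` (FKG on `β`). [this work] -/
theorem kplusMargin_le_sahiE_three [DistribLattice α] [DistribLattice β] [Preorder γ]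
    (hA : IsFKGMeasure wA) (hB : IsFKGMeasure wB) (hC0 : ∀ c, 0 ≤ wC c)
    (hf0 : ∀ c a, 0 ≤ f c a) (hg0 : ∀ c b, 0 ≤ g c b) (hgb : ∀ c, Monotone (g c))
    (hh0 : ∀ c a b, 0 ≤ h c a b) (hhb : ∀ c a, Monotone (h c a)) :
    kplusMargin wA wB wC f g h ≤
      sahiE (fun q : α × β × γ => wA q.1 * wB q.2.1 * wC q.2.2) 3
        ![fun q => f q.2.2 q.1, fun q => g q.2.2 q.2.1, fun q => h q.2.2 q.1 q.2.1] := by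
  rw [sahiE_three_eq_kplusMargin_add_fibreCov hA.sum_eq_one hB.sum_eq_one]
  exact le_add_of_nonneg_right (fibreCov_nonneg hA hB hC0 hf0 hg0 hgb hh0 hhb)

/-- **`M ≥ 0 ⟹ C_3` for the triple**: if the margin is nonnegative then `E_3(f,g,h) ≥ 0`. [this work] -/
theorem sahiE_three_nonneg_of_kplusMargin_nonneg [DistribLattice α] [DistribLattice β] [Preorder γ]
    (hA : IsFKGMeasure wA) (hB : IsFKGMeasure wB) (hC0 : ∀ c, 0 ≤ wC c)
    (hf0 : ∀ c a, 0 ≤ f c a) (hg0 : ∀ c b, 0 ≤ g c b) (hgb : ∀ c, Monotone (g c))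
    (hh0 : ∀ c a b, 0 ≤ h c a b) (hhb : ∀ c a, Monotone (h c a)) (hM : 0 ≤ kplusMargin wA wB wC f g h) :
    0 ≤ sahiE (fun q : α × β × γ => wA q.1 * wB q.2.1 * wC q.2.2) 3
        ![fun q => f q.2.2 q.1, fun q => g q.2.2 q.2.1, fun q => h q.2.2 q.1 q.2.1] :=
  hM.trans (kplusMargin_le_sahiE_three hA hB hC0 hf0 hg0 hgb hh0 hhb)

/-! ### 2. The S-form: `f` ignoring the block `α` -/

/-- `Ḡ = E_c G_C` (Fubini). [this work] -/
theorem Gbar_eq_sum_GC : Gbar wB wC g = ∑ c, wC c * GC wB g c := by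
  unfold Gbar GG GC
  exact swap_bc wB wC (fun b c => g c b)

/-- **S-FORM OF THE MARGIN.**  If `f c a = φ c` ignores `α` (and `Σ wA = 1`) then
`M = E_c[φ·(G_C − Ḡ)·(H̄ − EH)] + (E_c[φ K'] − E_c φ · E_c K')`, `K'(c) = E[gh | c]`. [this work] -/
theorem kplusMargin_eq_of_ignores (φ : γ → ℝ) (hf : ∀ c a, f c a = φ c) (hA1 : ∑ a, wA a = 1) :
    kplusMargin wA wB wC f g h =
      (∑ c, wC c * (φ c * ((GC wB g c - Gbar wB wC g) * (Hbar wA wB h c - EH wA wB wC h)))) +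
        ((∑ c, wC c * (φ c * KH wA wB g h c)) - (∑ c, wC c * φ c) * ∑ c, wC c * KH wA wB g h c) := by
  have hY : ∀ c b, Y wA f h c b = φ c * HH wA h c b := by
    intro c b; unfold Y HH; rw [mul_sum]
    exact sum_congr rfl fun a _ => by rw [hf]; ring
  have hF : ∀ c, FC wA f c = φ c := by
    intro c; unfold FC
    rw [show (∑ a, wA a * f c a) = ∑ a, wA a * φ c from sum_congr rfl fun a _ => by rw [hf], ← sum_mul, hA1, one_mul]
  have hYb : ∀ c, Ybar wA wB f h c = φ c * Hbar wA wB h c := by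
    intro c; unfold Ybar Hbar; rw [mul_sum]
    exact sum_congr rfl fun b _ => by rw [hY]; ring
  have hK : ∀ c, KK wA wB f g h c = φ c * KH wA wB g h c := by
    intro c; unfold KK KH; rw [mul_sum]
    exact sum_congr rfl fun b _ => by rw [hY]; ring
  have hEF : EF wA wC f = ∑ c, wC c * φ c := by
    unfold EF; exact sum_congr rfl fun c _ => by rw [hF]
  have hEH : EH wA wB wC h = ∑ c, wC c * Hbar wA wB h c := rfl
  unfold kplusMargin
  rw [hEF, Gbar_eq_sum_GC]
  simp only [hK, hYb, hF]
  unfold KH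
  set Gs : ℝ := ∑ c, wC c * GC wB g c with hGs
  set E : ℝ := EH wA wB wC h with hE
  -- expand the first summand of the right-hand side into moments
  have e1 : (∑ c, wC c * (φ c * ((GC wB g c - Gs) * (Hbar wA wB h c - E)))) =
      (∑ c, wC c * (GC wB g c * (φ c * Hbar wA wB h c))) - E * (∑ c, wC c * (φ c * GC wB g c)) -
        Gs * (∑ c, wC c * (φ c * Hbar wA wB h c)) + (Gs * E) * ∑ c, wC c * φ c := by
    rw [mul_sum, mul_sum, mul_sum, ← sum_sub_distrib, ← sum_sub_distrib, ← sum_add_distrib]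
    exact sum_congr rfl fun c _ => by ring
  rw [e1]
  ring

/-! ### 3. FKG restricted to a principal up-set -/

/-- The indicator of the principal up-set `{c | u₀ ≤ c}`. [this work] -/
def pind [Preorder γ] (u₀ : γ) (c : γ) : ℝ := if u₀ ≤ c then 1 else 0

omit [Fintype γ] in
/-- `pind` is `{0,1}`-valued, nonnegative and monotone. [this work] -/
theorem pind_spec [Preorder γ] (u₀ : γ) :
    (∀ c, 0 ≤ pind u₀ c) ∧ (∀ c, pind u₀ c ≤ 1) ∧ Monotone (pind u₀) ∧ (∀ c, pind u₀ c * pind u₀ c = pind u₀ c) := by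
  refine ⟨fun c => ?_, fun c => ?_, fun c c' hcc => ?_, fun c => ?_⟩
  · unfold pind; split_ifs <;> norm_num
  · unfold pind; split_ifs <;> norm_num
  · unfold pind
    by_cases hc : u₀ ≤ c
    · rw [if_pos hc, if_pos (hc.trans hcc)]
    · rw [if_neg hc]; split_ifs <;> norm_num
  · unfold pind; split_ifs <;> norm_num

/-- FKG in `Σ`-form for SIGNED monotone functions (shift to the nonnegative case). [folklore] -/
theorem fkg_sum_signed {δ : Type} [Fintype δ] [DistribLattice δ] {μ : δ → ℝ} (hμ : IsFKGMeasure μ) {u v : δ → ℝ}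
    (hum : Monotone u) (hvm : Monotone v) :
    (∑ x, μ x * u x) * (∑ x, μ x * v x) ≤ ∑ x, μ x * (u x * v x) := by
  set su : ℝ := ∑ x, |u x| with hsu
  set sv : ℝ := ∑ x, |v x| with hsv
  have hu0 : ∀ x, 0 ≤ u x + su := fun x => by
    have : |u x| ≤ su := by
      rw [hsu]; exact single_le_sum (f := fun y => |u y|) (fun y _ => abs_nonneg (u y)) (mem_univ x)
    linarith [neg_abs_le (u x)]
  have hv0 : ∀ x, 0 ≤ v x + sv := fun x => by
    have : |v x| ≤ sv := by
      rw [hsv]; exact single_le_sum (f := fun y => |v y|) (fun y _ => abs_nonneg (v y)) (mem_univ x)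
    linarith [neg_abs_le (v x)]
  have h1 := fkg_sum hμ (u := fun x => u x + su) (v := fun x => v x + sv) hu0 hv0
    (fun x y hxy => by simpa using hum hxy) (fun x y hxy => by simpa using hvm hxy)
  have hs := hμ.sum_eq_one
  have ea : (∑ x, μ x * (u x + su)) = (∑ x, μ x * u x) + su := by
    rw [show (∑ x, μ x * (u x + su)) = (∑ x, μ x * u x) + (∑ x, μ x) * su by
      rw [sum_mul, ← sum_add_distrib]; exact sum_congr rfl fun x _ => by ring, hs, one_mul]
  have eb : (∑ x, μ x * (v x + sv)) = (∑ x, μ x * v x) + sv := by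
    rw [show (∑ x, μ x * (v x + sv)) = (∑ x, μ x * v x) + (∑ x, μ x) * sv by
      rw [sum_mul, ← sum_add_distrib]; exact sum_congr rfl fun x _ => by ring, hs, one_mul]
  have ec : (∑ x, μ x * ((u x + su) * (v x + sv))) =
      (∑ x, μ x * (u x * v x)) + sv * (∑ x, μ x * u x) + su * (∑ x, μ x * v x) + su * sv := by
    rw [show (∑ x, μ x * ((u x + su) * (v x + sv))) =
        (∑ x, μ x * (u x * v x)) + sv * (∑ x, μ x * u x) + su * (∑ x, μ x * v x) + (∑ x, μ x) * (su * sv) by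
      rw [mul_sum, mul_sum, sum_mul, ← sum_add_distrib, ← sum_add_distrib, ← sum_add_distrib]
      exact sum_congr rfl fun x _ => by ring, hs, one_mul]
  rw [ea, eb, ec] at h1
  nlinarith [h1]

/-- **FKG RESTRICTED TO A PRINCIPAL UP-SET.**  For an FKG weight `μ` on a finite distributive lattice, `u₀ : δ` and monotone `A, B` (any sign):
`(Σ_{c ≥ u₀} μ A)(Σ_{c ≥ u₀} μ B) ≤ (Σ_{c ≥ u₀} μ)(Σ_{c ≥ u₀} μ A B)` — the principal up-set is a sublattice, so `μ·1_{≥ u₀}` (normalised) is again FKG.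
[folklore] -/
theorem fkg_sum_principal {δ : Type} [Fintype δ] [DistribLattice δ] {μ : δ → ℝ} (hμ : IsFKGMeasure μ) (u₀ : δ) {A B : δ → ℝ}
    (hA : Monotone A) (hB : Monotone B) :
    (∑ c, μ c * pind u₀ c * A c) * (∑ c, μ c * pind u₀ c * B c) ≤
      (∑ c, μ c * pind u₀ c) * ∑ c, μ c * pind u₀ c * (A c * B c) := by
  obtain ⟨hp0, hp1, hpm, hpp⟩ := pind_spec (γ := δ) u₀
  have hμ0 := hμ.nonneg
  set m : ℝ := ∑ c, μ c * pind u₀ c with hm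
  have hm0 : 0 ≤ m := sum_nonneg fun c _ => mul_nonneg (hμ0 c) (hp0 c)
  rcases hm0.eq_or_lt with hmz | hmpos
  · -- total restricted mass zero: every restricted weight vanishes
    have hz : ∀ c, μ c * pind u₀ c = 0 := fun c =>
      (sum_eq_zero_iff_of_nonneg (fun c _ => mul_nonneg (hμ0 c) (hp0 c))).mp hmz.symm c (mem_univ c)
    simp only [hz, zero_mul, mul_zero, sum_const_zero, le_refl]
  · -- normalised restriction is an FKG probability weight
    set μ' : δ → ℝ := fun c => μ c * pind u₀ c / m with hμ'
    have hFKG : IsFKGMeasure μ' := by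
      refine ⟨fun c => div_nonneg (mul_nonneg (hμ0 c) (hp0 c)) hmpos.le, ?_, fun a b => ?_⟩
      · show (∑ c, μ c * pind u₀ c / m) = 1
        rw [← sum_div, ← hm, div_self hmpos.ne']
      · show μ a * pind u₀ a / m * (μ b * pind u₀ b / m) ≤ μ (a ⊓ b) * pind u₀ (a ⊓ b) / m * (μ (a ⊔ b) * pind u₀ (a ⊔ b) / m)
        rw [div_mul_div_comm, div_mul_div_comm]
        refine div_le_div_of_nonneg_right ?_ (mul_pos hmpos hmpos).le
        by_cases ha : u₀ ≤ a
        · by_cases hb : u₀ ≤ b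
          · have hi : pind u₀ (a ⊓ b) = 1 := by unfold pind; rw [if_pos (le_inf ha hb)]
            have hs : pind u₀ (a ⊔ b) = 1 := by unfold pind; rw [if_pos (ha.trans le_sup_left)]
            have ha1 : pind u₀ a = 1 := by unfold pind; rw [if_pos ha]
            have hb1 : pind u₀ b = 1 := by unfold pind; rw [if_pos hb]
            rw [hi, hs, ha1, hb1, mul_one, mul_one, mul_one, mul_one]
            exact hμ.mul_le_mul a b
          · have hb0 : pind u₀ b = 0 := by unfold pind; rw [if_neg hb]
            rw [hb0, mul_zero, mul_zero]
            exact mul_nonneg (mul_nonneg (hμ0 _) (hp0 _)) (mul_nonneg (hμ0 _) (hp0 _))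
        · have ha0 : pind u₀ a = 0 := by unfold pind; rw [if_neg ha]
          rw [ha0, mul_zero, zero_mul]
          exact mul_nonneg (mul_nonneg (hμ0 _) (hp0 _)) (mul_nonneg (hμ0 _) (hp0 _))
    have h1 := fkg_sum_signed hFKG hA hB
    have e1 : (∑ c, μ' c * A c) = (∑ c, μ c * pind u₀ c * A c) / m := by
      rw [eq_div_iff hmpos.ne', sum_mul]; exact sum_congr rfl fun c _ => by rw [hμ']; field_simp
    have e2 : (∑ c, μ' c * B c) = (∑ c, μ c * pind u₀ c * B c) / m := by
      rw [eq_div_iff hmpos.ne', sum_mul]; exact sum_congr rfl fun c _ => by rw [hμ']; field_simp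
    have e3 : (∑ c, μ' c * (A c * B c)) = (∑ c, μ c * pind u₀ c * (A c * B c)) / m := by
      rw [eq_div_iff hmpos.ne', sum_mul]; exact sum_congr rfl fun c _ => by rw [hμ']; field_simp
    rw [e1, e2, e3, div_mul_div_comm, div_le_div_iff₀ (mul_pos hmpos hmpos) hmpos] at h1
    -- h1 : (ΣA)(ΣB) * m ≤ (ΣAB) * (m*m)
    nlinarith [h1, hmpos]

/-! ### 4. The margin is nonnegative for a principal first member -/

/-- **THEOREM (resampled margin with a principal first member).**  `γ` a finite distributive lattice with an FKG weight, `β` ANY finite type with a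
nonnegative weight, `α` any block with a probability weight; `f c a = 1[u₀ ≤ c]` (for cubes: a monomial), `g(c,b), h(c,a,b) ≥ 0` monotone in `c`.
Then `kplusMargin ≥ 0`.  PROOF: in the S-form, `Cov_c(1_U, K') ≥ 0` by FKG on `γ`, and `E_c[1_U (G_C − Ḡ)(H̄ − EH)] ≥ 0` because, by FKG
restricted to the sublattice `U`, `μ(U)·E_c[1_U(G_C−Ḡ)(H̄−EH)] ≥ E_c[1_U(G_C−Ḡ)]·E_c[1_U(H̄−EH)]`, both factors `≥ 0` by FKG on `γ`. [this work] -/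
theorem kplusMargin_nonneg_of_principal [DistribLattice γ] (hC : IsFKGMeasure wC)
    (hA0 : ∀ a, 0 ≤ wA a) (hA1 : ∑ a, wA a = 1) (hB0 : ∀ b, 0 ≤ wB b) (u₀ : γ) (hf : ∀ c a, f c a = pind u₀ c)
    (hg0 : ∀ c b, 0 ≤ g c b) (hgc : ∀ b, Monotone (fun c => g c b))
    (hh0 : ∀ c a b, 0 ≤ h c a b) (hhc : ∀ a b, Monotone (fun c => h c a b)) :
    0 ≤ kplusMargin wA wB wC f g h := by
  obtain ⟨hp0, hp1, hpm, hpp⟩ := pind_spec (γ := γ) u₀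
  have hC0 := hC.nonneg
  rw [kplusMargin_eq_of_ignores (pind u₀) hf hA1]
  -- monotonicity / nonnegativity of the γ-marginals
  have hHH0 : ∀ c b, 0 ≤ HH wA h c b := fun c b => sum_nonneg fun a _ => mul_nonneg (hA0 a) (hh0 c a b)
  have hHHc : ∀ b, Monotone (fun c => HH wA h c b) := fun b c c' hcc =>
    sum_le_sum fun a _ => mul_le_mul_of_nonneg_left (hhc a b hcc) (hA0 a)
  have hGC0 : ∀ c, 0 ≤ GC wB g c := fun c => sum_nonneg fun b _ => mul_nonneg (hB0 b) (hg0 c b)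
  have hGCm : Monotone (GC wB g) := fun c c' hcc => sum_le_sum fun b _ => mul_le_mul_of_nonneg_left (hgc b hcc) (hB0 b)
  have hHb0 : ∀ c, 0 ≤ Hbar wA wB h c := fun c => sum_nonneg fun b _ => mul_nonneg (hB0 b) (hHH0 c b)
  have hHbm : Monotone (Hbar wA wB h) := fun c c' hcc => sum_le_sum fun b _ => mul_le_mul_of_nonneg_left (hHHc b hcc) (hB0 b)
  have hK0 : ∀ c, 0 ≤ KH wA wB g h c := fun c => sum_nonneg fun b _ => mul_nonneg (hB0 b) (mul_nonneg (hg0 c b) (hHH0 c b))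
  have hKm : Monotone (KH wA wB g h) := fun c c' hcc => sum_le_sum fun b _ =>
    mul_le_mul_of_nonneg_left (mul_le_mul (hgc b hcc) (hHHc b hcc) (hHH0 c b) (hg0 c' b)) (hB0 b)
  -- second summand: Cov_c(1_U, K') ≥ 0 by FKG on γ
  have hT2 : 0 ≤ (∑ c, wC c * (pind u₀ c * KH wA wB g h c)) - (∑ c, wC c * pind u₀ c) * ∑ c, wC c * KH wA wB g h c :=
    sub_nonneg.mpr (fkg_sum hC hp0 hK0 hpm hKm)
  -- first summand
  have hT1 : 0 ≤ ∑ c, wC c * (pind u₀ c * ((GC wB g c - Gbar wB wC g) * (Hbar wA wB h c - EH wA wB wC h))) := by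
    have hAm : Monotone (fun c => GC wB g c - Gbar wB wC g) := fun c c' hcc => sub_le_sub_right (hGCm hcc) _
    have hBm : Monotone (fun c => Hbar wA wB h c - EH wA wB wC h) := fun c c' hcc => sub_le_sub_right (hHbm hcc) _
    have key := fkg_sum_principal hC u₀ hAm hBm
    -- the two restricted first moments are ≥ 0 (FKG on γ against the indicator)
    have hG1 : 0 ≤ ∑ c, wC c * pind u₀ c * (GC wB g c - Gbar wB wC g) := by
      have h1 := fkg_sum hC hp0 hGC0 hpm hGCm
      rw [← Gbar_eq_sum_GC] at h1
      have e : (∑ c, wC c * pind u₀ c * (GC wB g c - Gbar wB wC g)) =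
          (∑ c, wC c * (pind u₀ c * GC wB g c)) - (∑ c, wC c * pind u₀ c) * Gbar wB wC g := by
        rw [sum_mul, ← sum_sub_distrib]; exact sum_congr rfl fun c _ => by ring
      rw [e]; linarith
    have hH1 : 0 ≤ ∑ c, wC c * pind u₀ c * (Hbar wA wB h c - EH wA wB wC h) := by
      have h1 := fkg_sum hC hp0 hHb0 hpm hHbm
      have eEH : EH wA wB wC h = ∑ c, wC c * Hbar wA wB h c := rfl
      have e : (∑ c, wC c * pind u₀ c * (Hbar wA wB h c - EH wA wB wC h)) =
          (∑ c, wC c * (pind u₀ c * Hbar wA wB h c)) - (∑ c, wC c * pind u₀ c) * EH wA wB wC h := by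
        rw [sum_mul, ← sum_sub_distrib]; exact sum_congr rfl fun c _ => by ring
      rw [e, eEH]; linarith
    have hm0 : 0 ≤ ∑ c, wC c * pind u₀ c := sum_nonneg fun c _ => mul_nonneg (hC0 c) (hp0 c)
    have eT : (∑ c, wC c * (pind u₀ c * ((GC wB g c - Gbar wB wC g) * (Hbar wA wB h c - EH wA wB wC h)))) =
        ∑ c, wC c * pind u₀ c * ((GC wB g c - Gbar wB wC g) * (Hbar wA wB h c - EH wA wB wC h)) :=
      sum_congr rfl fun c _ => by ring
    rw [eT]
    rcases hm0.eq_or_lt with hmz | hmpos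
    · have hz : ∀ c, wC c * pind u₀ c = 0 := fun c =>
        (sum_eq_zero_iff_of_nonneg (fun c _ => mul_nonneg (hC0 c) (hp0 c))).mp hmz.symm c (mem_univ c)
      simp only [hz, zero_mul, sum_const_zero, le_refl]
    · have hprod : 0 ≤ (∑ c, wC c * pind u₀ c * (GC wB g c - Gbar wB wC g)) *
          ∑ c, wC c * pind u₀ c * (Hbar wA wB h c - EH wA wB wC h) := mul_nonneg hG1 hH1
      exact (mul_nonneg_iff_of_pos_left hmpos).mp (hprod.trans key)
  exact add_nonneg hT1 hT2

/-- **COROLLARY (Sahi's `C_3` with a principal first member, every FKG product of blocks).**  Under the hypotheses of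
`kplusMargin_nonneg_of_principal` plus FKG on `α, β` and monotonicity of `g, h` in `b`: `E_3(1_{[u₀,⊤]}, g, h) ≥ 0`. [this work] -/
theorem sahiE_three_nonneg_of_principal [DistribLattice α] [DistribLattice β] [DistribLattice γ]
    (hA : IsFKGMeasure wA) (hB : IsFKGMeasure wB) (hC : IsFKGMeasure wC) (u₀ : γ) (hf : ∀ c a, f c a = pind u₀ c)
    (hg0 : ∀ c b, 0 ≤ g c b) (hgb : ∀ c, Monotone (g c)) (hgc : ∀ b, Monotone (fun c => g c b))
    (hh0 : ∀ c a b, 0 ≤ h c a b) (hhb : ∀ c a, Monotone (h c a)) (hhc : ∀ a b, Monotone (fun c => h c a b)) :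
    0 ≤ sahiE (fun q : α × β × γ => wA q.1 * wB q.2.1 * wC q.2.2) 3
        ![fun q => f q.2.2 q.1, fun q => g q.2.2 q.2.1, fun q => h q.2.2 q.1 q.2.1] :=
  sahiE_three_nonneg_of_kplusMargin_nonneg hA hB hC.nonneg (fun c a => by rw [hf]; exact (pind_spec u₀).1 c) hg0 hgb hh0 hhb
    (kplusMargin_nonneg_of_principal hC hA.nonneg hA.sum_eq_one hB.nonneg u₀ hf hg0 hgc hh0 hhc)
end Main

/-! ### 5. The margin CAN be negative: the resampled inequality `M ≥ 0` is false in general (exhaustive 4-cube census, kit j194784) -/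

section Counterexample
/-- Uniform weight on a coin. [this work] -/
def wHalf : Bool → ℝ := fun _ => 1 / 2
/-- Uniform weight on two coins. [this work] -/
def wQuarter : Bool × Bool → ℝ := fun _ => 1 / 4
/-- `f = x₀ ∨ x₁` (`c = x₀`, `a = x₁`). [this work] -/
def fEx : Bool → Bool → ℝ := fun c a => if (c || a) then 1 else 0
/-- `g = x₂ ∧ (x₀ ∨ x₃)` (`b = (x₂, x₃)`). [this work] -/
def gEx : Bool → Bool × Bool → ℝ := fun c b => if (b.1 && (c || b.2)) then 1 else 0
/-- `h = x₃ ∧ (x₁ ∨ x₂)`. [this work] -/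
def hEx : Bool → Bool → Bool × Bool → ℝ := fun _ a b => if (b.2 && (a || b.1)) then 1 else 0

/-- **THE RESAMPLED MARGIN IS NEGATIVE** on the class-T triple `(x₀ ∨ x₁, x₂(x₀ ∨ x₃), x₃(x₁ ∨ x₂))` of the uniform 4-cube (blocks `γ = {x₀}`,
`α = {x₁}`, `β = {x₂,x₃}`): `M = −1/256` (here `gh = x₂x₃` is independent of `f`, so `Cov(f,gh) = 0`, while `Cov_c(G_C, Ȳ − EH·F) = −1/256`).
So `E_3 ≥ E_c Cov_b(g_c, Y_c)` — Kahn's inequality with one `E[fgh]` resampled on the block `β` — FAILS, already in class T; the worst of the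
1 800 failing cells among the 343 072 200 of the exhaustive ordered 4-cube census (75 bias vectors) is exactly this one. [this work] -/
theorem kplusMargin_example_neg : kplusMargin wHalf wQuarter wHalf fEx gEx hEx = -1 / 256 := by
  unfold kplusMargin KK
  norm_num [SahiSharedTwoPoint.Y, SahiSharedTwoPoint.FC, SahiSharedTwoPoint.HH, SahiSharedTwoPoint.GC, SahiSharedTwoPoint.Ybar,
    SahiSharedTwoPoint.Hbar, SahiSharedTwoPoint.EH, SahiSharedTwoPoint.EF, SahiSharedTwoPoint.Gbar, SahiSharedTwoPoint.GG,
    Fintype.sum_bool, Fintype.sum_prod_type, wHalf, wQuarter, fEx, gEx, hEx]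

/-- The fibre covariance of the same triple is `1/16`, so `E_3 = −1/256 + 16/256 = 15/256 > 0` (Kahn's inequality holds, with the resampled
slack spent). [this work] -/
theorem fibreCov_example : fibreCov wHalf wQuarter wHalf fEx gEx hEx = 1 / 16 := by
  unfold fibreCov KK
  norm_num [SahiSharedTwoPoint.Y, SahiSharedTwoPoint.GC, SahiSharedTwoPoint.Ybar, Fintype.sum_bool, Fintype.sum_prod_type,
    wHalf, wQuarter, fEx, gEx, hEx]

/-- `E_3` of the example is `15/256`. [this work] -/
theorem sahiE_three_example :
    sahiE (fun q : Bool × (Bool × Bool) × Bool => wHalf q.1 * wQuarter q.2.1 * wHalf q.2.2) 3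
        ![fun q => fEx q.2.2 q.1, fun q => gEx q.2.2 q.2.1, fun q => hEx q.2.2 q.1 q.2.1] = 15 / 256 := by
  have hA1 : ∑ a, wHalf a = 1 := by norm_num [Fintype.sum_bool, wHalf]
  have hB1 : ∑ b, wQuarter b = 1 := by norm_num [Fintype.sum_prod_type, Fintype.sum_bool, wQuarter]
  rw [sahiE_three_eq_kplusMargin_add_fibreCov hA1 hB1, kplusMargin_example_neg, fibreCov_example]
  norm_num
end Counterexample

end SahiResampledMargin

end Summit.CriticalPhenomena.PercolationContinuityZ3.Theorems
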